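import Literature.NumberTheory.LFunctions.ConreyIwaniec2002Prop91Floor
import HarnessLib

/-!
# Conrey–Iwaniec (2002), §9: the summand of `E(T)` POINTWISE at heights `≍ T ≥ q^{65}`

B. Conrey, H. Iwaniec, *Spacing of zeros of Hecke L-functions and the class number problem*,
Acta Arith. 103 (2002), §§7–9 [held text `paper:arxiv-math_0111012`, p0017–p0020]: the summand
`|ℓ(s)M̄(s) − x(s)|` of `E(T)` (9.6) is LINEAR in the divided difference `ℓ(s)`.

Purpose (cell landau-siegel / ls-inputs, I6b): the floor mean values
(`ConreyIwaniec2002Prop91Floor`) handle the points of `S ⊂ (T, 2T]` above `q^{65} + 2q + 2`;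
the at most `2q + 4` points below are handled HERE one by one, with the convexity-strength
pointwise bounds `|A(s)|², |B(s)|² ≪ qT(log T)^{O(1)}` (`B = (A(s) − A(s′))/(s − s′)`, from the
weight bound `‖Ω_{t,t′}(u)‖ ≪ (1 + e^u/Q|s|)^{−6}(1 + |u|)` of `afeWeight_bounds`, Cauchy and the
divisor second moment), `|M(s)| ≤ q²(1 + 4 log q)²`, `|x(s)| ≪ log qT`, `|r(s)| ≪ 1`, the far /
remote pointwise inequalities of the tree, and the coincident-companion limit for `E`
(`defectE_limit`). Result: `bottom_pointwise` —
`|ℓ(s)M̄(s) − x(s)| ≤ C·q³·√T·(log T)^6` for `T < t ≤ 2T`, `q^{65} ≤ T`, `t′ ≠ t` arbitrary —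
which is `≪ T` per point since `T ≥ q^{65}`. Everything PROVED; no definition.

«The programme SEARCHES and TYPES; no claim about Landau–Siegel zeros until a kernel theorem says so.»

## References
* [ConreyIwaniec2002] B. Conrey, H. Iwaniec, Acta Arith. 103 (2002) 259–312, arXiv:math/0111012:
  Proposition 7.1 (7.12), Lemma 7.2 (7.16), (7.19)–(7.23), (7.26), §8 (8.8), §9 (9.4)–(9.6).
-/

noncomputable section

open scoped NumberField ComplexConjugate Topology
open Complex Filter

namespace Literature.NumberTheory.LFunctions

namespace ConreyIwaniec2002

open NumberField

/-! ### §1. A weighted harmonic sum -/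

/-- `Σ_{n ∈ s} n^{−1}(1 + n/Y)^{−2} ≤ 3 + log Y` for `Y ≥ 2` and any finite `s ⊂ ℕ` (harmonic part
`n ≤ Y`: `≤ 1 + log Y`; tail `n > Y`: `n^{−1}(1+n/Y)^{−2} ≤ Y/n²`, `Σ_{n>Y} n^{−2} ≤ 2/Y`);
private plumbing (the tree's `sum_inv_mul_weight_le` with exponent `2`). [folklore] -/
private theorem sum_inv_mul_weight_two_le (s : Finset ℕ) {Y : ℝ} (hY : 2 ≤ Y) :
    ∑ n ∈ s, ((n : ℝ)⁻¹ * ((1 + (n : ℝ) / Y) ^ 2)⁻¹) ≤ 3 + Real.log Y := by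
  classical
  have hY0 : 0 < Y := by linarith
  set M : ℕ := ⌊Y⌋₊ with hM
  have hMY : (M : ℝ) ≤ Y := Nat.floor_le hY0.le
  have hYM : Y < (M : ℝ) + 1 := Nat.lt_floor_add_one Y
  have hM2 : 2 ≤ M := by
    rw [hM]; exact Nat.le_floor (by exact_mod_cast hY)
  have hf0 : ∀ n : ℕ, 0 ≤ (n : ℝ)⁻¹ * ((1 + (n : ℝ) / Y) ^ 2)⁻¹ := fun n => by positivity
  rw [← Finset.sum_filter_add_sum_filter_not s (fun n => n ≤ M)]
  have h1 : ∑ n ∈ s.filter (fun n => n ≤ M), ((n : ℝ)⁻¹ * ((1 + (n : ℝ) / Y) ^ 2)⁻¹) ≤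
      1 + Real.log Y := by
    calc ∑ n ∈ s.filter (fun n => n ≤ M), ((n : ℝ)⁻¹ * ((1 + (n : ℝ) / Y) ^ 2)⁻¹)
        ≤ ∑ n ∈ Finset.range (M + 1), ((n : ℝ)⁻¹ * ((1 + (n : ℝ) / Y) ^ 2)⁻¹) := by
          refine Finset.sum_le_sum_of_subset_of_nonneg (fun n hn => ?_) fun n _ _ => hf0 n
          rw [Finset.mem_filter] at hn
          exact Finset.mem_range.2 (by omega)
      _ ≤ ∑ n ∈ Finset.range (M + 1), (n : ℝ)⁻¹ := by
          refine Finset.sum_le_sum fun n _ => ?_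
          have h1 : ((1 + (n : ℝ) / Y) ^ 2)⁻¹ ≤ 1 := by
            apply inv_le_one_of_one_le₀
            exact one_le_pow₀ (le_add_of_nonneg_right (by positivity))
          have h0 : 0 ≤ (n : ℝ)⁻¹ := by positivity
          nlinarith
      _ = ∑ n ∈ Finset.Icc 1 M, (n : ℝ)⁻¹ := by
          rw [Finset.range_eq_Ico, ← Finset.insert_Ico_succ_left_eq_Ico (Nat.succ_pos M),
            Finset.sum_insert (by simp)]
          simp [Finset.Ico_add_one_right_eq_Icc]
      _ = (harmonic M : ℝ) := by
          rw [harmonic_eq_sum_Icc]; push_cast; rfl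
      _ ≤ 1 + Real.log M := harmonic_le_one_add_log M
      _ ≤ 1 + Real.log Y := by
          have : (0 : ℝ) < M := by exact_mod_cast (by omega : 0 < M)
          linarith [Real.log_le_log this hMY]
  have h2 : ∑ n ∈ s.filter (fun n => ¬ n ≤ M), ((n : ℝ)⁻¹ * ((1 + (n : ℝ) / Y) ^ 2)⁻¹) ≤ 2 := by
    have hsub : s.filter (fun n => ¬ n ≤ M) ⊆ Finset.Ioo M (s.sup id + 1) := by
      intro n hn
      rw [Finset.mem_filter] at hn
      rw [Finset.mem_Ioo]
      refine ⟨by omega, Nat.lt_succ_of_le ?_⟩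
      exact Finset.le_sup (f := id) hn.1
    calc ∑ n ∈ s.filter (fun n => ¬ n ≤ M), ((n : ℝ)⁻¹ * ((1 + (n : ℝ) / Y) ^ 2)⁻¹)
        ≤ ∑ n ∈ Finset.Ioo M (s.sup id + 1), ((n : ℝ)⁻¹ * ((1 + (n : ℝ) / Y) ^ 2)⁻¹) :=
          Finset.sum_le_sum_of_subset_of_nonneg hsub fun n _ _ => hf0 n
      _ ≤ ∑ n ∈ Finset.Ioo M (s.sup id + 1), Y * ((n : ℝ) ^ 2)⁻¹ := by
          refine Finset.sum_le_sum fun n hn => ?_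
          rw [Finset.mem_Ioo] at hn
          have hn1 : (M : ℝ) + 1 ≤ n := by exact_mod_cast hn.1
          have hnpos : (0 : ℝ) < n := by linarith
          have hYn : Y ≤ n := by linarith
          have hge : (n : ℝ) / Y ≤ (1 + (n : ℝ) / Y) ^ 2 := by
            have h0 : 0 ≤ (n : ℝ) / Y := by positivity
            calc (n : ℝ) / Y ≤ 1 + (n : ℝ) / Y := by linarith
              _ ≤ (1 + (n : ℝ) / Y) ^ 2 := le_self_pow₀ (by linarith) (by norm_num)
          have hpos : 0 < (n : ℝ) / Y := by positivity
          calc (n : ℝ)⁻¹ * ((1 + (n : ℝ) / Y) ^ 2)⁻¹ ≤ (n : ℝ)⁻¹ * ((n : ℝ) / Y)⁻¹ := by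
                gcongr
            _ = Y * ((n : ℝ) ^ 2)⁻¹ := by field_simp
      _ = Y * ∑ n ∈ Finset.Ioo M (s.sup id + 1), ((n : ℝ) ^ 2)⁻¹ := by rw [Finset.mul_sum]
      _ ≤ Y * (2 / ((M : ℝ) + 1)) := by
          gcongr
          exact sum_Ioo_inv_sq_le M (s.sup id + 1)
      _ ≤ 2 := by
          rw [mul_div_assoc', div_le_iff₀ (by positivity)]
          nlinarith
  linarith

/-! ### §2. The divided difference `B(s)` of the main sum, pointwise -/

/-- **`|B(s)|² ≤ C·Y₂(1 + log Y₂)⁶(3 + log Y₂)`**, `B(s) = (A(s) − A(s′))/(s − s′)`, `Y₂ = Q(|s| + 1) + 2`,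
for `s = ½+it`, `s′ = ½+it′`, `|t| ≥ 2`, `0 < |t − t′| ≤ 1`: from
`B = Σ_n λ(n)n^{−1/2}Ω_{t,t′}(log n)n^{−it}` (`afeA_dividedDiff_eq_tsum`), the weight bound
`‖Ω(u)‖ ≤ C(1+e^u/Q|s|)^{−6} + C(1+e^u/Q|s′|)^{−6}|u|` (`afeWeight_bounds`), `|λ(n)| ≤ d(n)`,
`1 + log n ≤ (1 + log Y₂)(1 + n/Y₂)`, Cauchy, `Σ d(n)²(1+n/Y)^{−8} ≪ Y(1+log Y)^4` and
`Σ n^{−1}(1+n/Y)^{−2} ≤ 3 + log Y` — convexity strength in the height.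
[cite: ConreyIwaniec2002, §7 (7.21)–(7.23), Lemma 7.2 (7.16), Lemma 7.4 (7.25)] -/
theorem norm_afeB_sq_le_conv :
    ∃ C : ℝ, 0 < C ∧
    ∀ (q : ℕ) [NeZero q], 4 < q → ∀ χ : DirichletCharacter ℂ q,
      χ.IsPrimitive → χ.IsQuadratic → χ.Odd →
        ∀ (K : Type) [Field K] [NumberField K],
          Module.finrank ℚ K = 2 → NumberField.discr K = -(q : ℤ) →
            ∀ (ψ : ClassGroup (𝓞 K) →* ℂˣ) (t t' : ℝ), 2 ≤ |t| → t' ≠ t → |t' - t| ≤ 1 →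
              ‖(afeA K ψ q (1 / 2 + t * I) - afeA K ψ q (1 / 2 + t' * I)) / ((t : ℂ) * I - t' * I)‖ ^ 2 ≤
                C * (condQ q * (‖(1 / 2 : ℂ) + t * I‖ + 1) + 2) *
                  (1 + Real.log (condQ q * (‖(1 / 2 : ℂ) + t * I‖ + 1) + 2)) ^ 6 *
                  (3 + Real.log (condQ q * (‖(1 / 2 : ℂ) + t * I‖ + 1) + 2)) := by
  obtain ⟨CΩ, hCΩ, -, hΩ⟩ := afeWeight_bounds
  obtain ⟨Cd, hCd, hdiv⟩ := divisorSq_weighted_tsum_le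
  refine ⟨CΩ ^ 2 * Cd, by positivity, fun q _ hq χ hprim hquad hodd K _ _ h2 hdisc ψ t t' ht htt' hdist => ?_⟩
  classical
  have hq0 : 0 < q := by omega
  set w : ℂ := 1 / 2 + t * I with hw
  set w' : ℂ := 1 / 2 + t' * I with hw'
  have hwim : |w.im| = |t| := by simp [hw]
  have hw0 : 0 < ‖w‖ := by
    have := Complex.abs_im_le_norm w
    rw [hwim] at this
    linarith
  have hw'0 : 0 < ‖w'‖ := by
    have h1 := Complex.abs_im_le_norm w'
    have h2 : |w'.im| = |t'| := by simp [hw']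
    have h3 : |t| - |t'| ≤ |t' - t| := by rw [abs_sub_comm]; exact abs_sub_abs_le_abs_sub t t'
    rw [h2] at h1
    linarith
  have hww' : ‖w'‖ ≤ ‖w‖ + 1 := by
    have h1 : ‖w'‖ ≤ ‖w‖ + ‖w' - w‖ := by
      calc ‖w'‖ = ‖w + (w' - w)‖ := by rw [add_sub_cancel]
        _ ≤ ‖w‖ + ‖w' - w‖ := norm_add_le _ _
    have h2 : ‖w' - w‖ = |t - t'| := by rw [hw', hw]; exact norm_half_sub_half t' t
    rw [abs_sub_comm] at h2
    linarith
  have hQ : 0 < condQ q := condQ_pos hq0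
  set Y₂ : ℝ := condQ q * (‖w‖ + 1) + 2 with hY₂
  have hY₂2 : 2 ≤ Y₂ := by
    have : 0 ≤ condQ q * (‖w‖ + 1) := by positivity
    rw [hY₂]; linarith
  have hY₂0 : 0 < Y₂ := by linarith
  have hY₂1 : 1 ≤ Y₂ := by linarith
  have hlogY₂ : 0 ≤ Real.log Y₂ := Real.log_nonneg hY₂1
  have hQw : condQ q * ‖w‖ ≤ Y₂ := by rw [hY₂]; nlinarith
  have hQw' : condQ q * ‖w'‖ ≤ Y₂ := by
    have : condQ q * ‖w'‖ ≤ condQ q * (‖w‖ + 1) := mul_le_mul_of_nonneg_left hww' hQ.le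
    rw [hY₂]; linarith
  -- the series for `B`
  obtain ⟨hsumB, hBeq⟩ := afeA_dividedDiff_eq_tsum hq hprim hquad hodd K h2 hdisc ψ ht htt' hdist
  have hlam := norm_twistCount_le_card_divisors hprim hquad hodd K h2 hdisc ψ
  set f : ℕ → ℂ := fun n => twistCount K (classGroupCharIdealHom ψ) n * (n : ℂ) ^ (-(1 / 2 : ℂ)) *
    afeOmega q t t' (Real.log n) * (n : ℂ) ^ (-((t : ℂ) * I)) with hf
  -- the two factors of Cauchy
  set a : ℕ → ℝ := fun n => (n.divisors.card : ℝ) * ((1 + (n : ℝ) / Y₂) ^ 4)⁻¹ with ha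
  set b : ℕ → ℝ := fun n => (n : ℝ) ^ (-(1 / 2 : ℝ)) * ((1 + (n : ℝ) / Y₂) ^ 1)⁻¹ with hb
  -- comparison of the decay factors
  have hdec : ∀ (Z : ℝ) (n : ℕ), 0 < Z → Z ≤ Y₂ →
      ((1 + (n : ℝ) / Z) ^ 6)⁻¹ ≤ ((1 + (n : ℝ) / Y₂) ^ 6)⁻¹ := by
    intro Z n hZ hZY
    apply inv_anti₀ (by positivity)
    apply pow_le_pow_left₀ (by positivity)
    have : (n : ℝ) / Y₂ ≤ (n : ℝ) / Z := div_le_div_of_nonneg_left (Nat.cast_nonneg n) hZ hZY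
    linarith
  -- `1 + log n ≤ (1 + log Y₂)(1 + n/Y₂)` for `n ≥ 1`
  have hlogn : ∀ n : ℕ, n ≠ 0 → 1 + Real.log n ≤ (1 + Real.log Y₂) * (1 + (n : ℝ) / Y₂) := by
    intro n hn
    have hn0 : (0 : ℝ) < n := by exact_mod_cast Nat.pos_of_ne_zero hn
    have h1 : Real.log n ≤ Real.log (Y₂ * (1 + (n : ℝ) / Y₂)) := by
      apply Real.log_le_log hn0
      have : Y₂ * (1 + (n : ℝ) / Y₂) = Y₂ + n := by field_simp
      rw [this]; linarith
    have h2 : Real.log (Y₂ * (1 + (n : ℝ) / Y₂)) = Real.log Y₂ + Real.log (1 + (n : ℝ) / Y₂) :=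
      Real.log_mul hY₂0.ne' (by positivity)
    have h3 : Real.log (1 + (n : ℝ) / Y₂) ≤ (n : ℝ) / Y₂ := by
      have := Real.log_le_sub_one_of_pos (show 0 < 1 + (n : ℝ) / Y₂ by positivity)
      linarith
    have h4 : 0 ≤ Real.log Y₂ * ((n : ℝ) / Y₂) := by positivity
    nlinarith
  -- termwise bound `‖f n‖ ≤ CΩ (1 + log Y₂) · a n · b n`
  have hterm : ∀ n : ℕ, ‖f n‖ ≤ CΩ * (1 + Real.log Y₂) * (a n * b n) := by
    intro n
    rcases eq_or_ne n 0 with rfl | hn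
    · simp [hf, twistCount_zero, ha, hb]
    have hn0 : (0 : ℝ) < n := by exact_mod_cast Nat.pos_of_ne_zero hn
    have hn1 : (1 : ℝ) ≤ n := by exact_mod_cast Nat.pos_of_ne_zero hn
    have hexp : Real.exp (Real.log n) = n := Real.exp_log hn0
    obtain ⟨-, hΩn, -⟩ := hΩ q hq0 t t' (Real.log n) ht htt' hdist
    rw [hexp] at hΩn
    have hlogn0 : 0 ≤ Real.log n := Real.log_nonneg hn1
    rw [abs_of_nonneg hlogn0] at hΩn
    -- `‖Ω(log n)‖ ≤ CΩ (1+n/Y₂)^{-6} (1 + log n) ≤ CΩ (1 + log Y₂)(1+n/Y₂)^{-5}`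
    have hd1 := hdec (condQ q * ‖w‖) n (by positivity) hQw
    have hd2 := hdec (condQ q * ‖w'‖) n (by positivity) hQw'
    rw [show (n : ℝ) / condQ q / ‖(1 / 2 : ℂ) + t * I‖ = (n : ℝ) / (condQ q * ‖w‖) by rw [hw, div_div],
      show (n : ℝ) / condQ q / ‖(1 / 2 : ℂ) + t' * I‖ = (n : ℝ) / (condQ q * ‖w'‖) by rw [hw', div_div]] at hΩn
    have hD0 : 0 ≤ ((1 + (n : ℝ) / Y₂) ^ 6)⁻¹ := by positivity
    have hΩle : ‖afeOmega q t t' (Real.log n)‖ ≤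
        CΩ * (1 + Real.log Y₂) * (((1 + (n : ℝ) / Y₂) ^ 6)⁻¹ * (1 + (n : ℝ) / Y₂)) := by
      calc ‖afeOmega q t t' (Real.log n)‖
          ≤ CΩ * ((1 + (n : ℝ) / (condQ q * ‖w‖)) ^ 6)⁻¹ +
              CΩ * ((1 + (n : ℝ) / (condQ q * ‖w'‖)) ^ 6)⁻¹ * Real.log n := hΩn
        _ ≤ CΩ * ((1 + (n : ℝ) / Y₂) ^ 6)⁻¹ + CΩ * ((1 + (n : ℝ) / Y₂) ^ 6)⁻¹ * Real.log n := by
            gcongr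
        _ = CΩ * ((1 + (n : ℝ) / Y₂) ^ 6)⁻¹ * (1 + Real.log n) := by ring
        _ ≤ CΩ * ((1 + (n : ℝ) / Y₂) ^ 6)⁻¹ * ((1 + Real.log Y₂) * (1 + (n : ℝ) / Y₂)) :=
            mul_le_mul_of_nonneg_left (hlogn n hn) (by positivity)
        _ = CΩ * (1 + Real.log Y₂) * (((1 + (n : ℝ) / Y₂) ^ 6)⁻¹ * (1 + (n : ℝ) / Y₂)) := by ring
    have hsplit : ((1 + (n : ℝ) / Y₂) ^ 6)⁻¹ * (1 + (n : ℝ) / Y₂) =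
        ((1 + (n : ℝ) / Y₂) ^ 4)⁻¹ * ((1 + (n : ℝ) / Y₂) ^ 1)⁻¹ := by
      have hx : 0 < 1 + (n : ℝ) / Y₂ := by positivity
      field_simp
    have hrpow : ‖(n : ℂ) ^ (-(1 / 2 : ℂ))‖ = (n : ℝ) ^ (-(1 / 2 : ℝ)) := by
      rw [show (-(1 / 2 : ℂ)) = ((-(1 / 2 : ℝ) : ℝ) : ℂ) by push_cast; ring,
        Complex.norm_natCast_cpow_of_pos (Nat.pos_of_ne_zero hn), Complex.ofReal_re]
    have hph : ‖(n : ℂ) ^ (-((t : ℂ) * I))‖ ≤ 1 := WeightedMeanValue.norm_natCast_cpow_neg_mul_I_le n t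
    have hnn : 0 ≤ (n : ℝ) ^ (-(1 / 2 : ℝ)) := Real.rpow_nonneg hn0.le _
    calc ‖f n‖ = ‖twistCount K (classGroupCharIdealHom ψ) n‖ * (n : ℝ) ^ (-(1 / 2 : ℝ)) *
          ‖afeOmega q t t' (Real.log n)‖ * ‖(n : ℂ) ^ (-((t : ℂ) * I))‖ := by
          simp only [hf, norm_mul, hrpow]
      _ ≤ (n.divisors.card : ℝ) * (n : ℝ) ^ (-(1 / 2 : ℝ)) *
          (CΩ * (1 + Real.log Y₂) * (((1 + (n : ℝ) / Y₂) ^ 6)⁻¹ * (1 + (n : ℝ) / Y₂))) * 1 := by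
          have h1 : ‖twistCount K (classGroupCharIdealHom ψ) n‖ * (n : ℝ) ^ (-(1 / 2 : ℝ)) ≤
              (n.divisors.card : ℝ) * (n : ℝ) ^ (-(1 / 2 : ℝ)) :=
            mul_le_mul_of_nonneg_right (hlam n) hnn
          have h2 : 0 ≤ (n.divisors.card : ℝ) * (n : ℝ) ^ (-(1 / 2 : ℝ)) :=
            mul_nonneg (Nat.cast_nonneg _) hnn
          have h3 : 0 ≤ CΩ * (1 + Real.log Y₂) * (((1 + (n : ℝ) / Y₂) ^ 6)⁻¹ * (1 + (n : ℝ) / Y₂)) := by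
            positivity
          exact mul_le_mul (mul_le_mul h1 hΩle (norm_nonneg _) h2) hph (norm_nonneg _)
            (mul_nonneg h2 h3)
      _ = CΩ * (1 + Real.log Y₂) * (a n * b n) := by
          rw [hsplit]; simp only [ha, hb]; ring
  -- the two finite Cauchy factors
  have hA2 : ∀ s : Finset ℕ, ∑ n ∈ s, a n ^ 2 ≤ Cd * Y₂ * (1 + Real.log Y₂) ^ 4 := by
    intro s
    obtain ⟨hsd, hbd⟩ := hdiv Y₂ hY₂2
    calc ∑ n ∈ s, a n ^ 2 = ∑ n ∈ s, ((1 + (n : ℝ) / Y₂) ^ 8)⁻¹ * (n.divisors.card : ℝ) ^ 2 := by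
          refine Finset.sum_congr rfl fun n _ => ?_
          rw [ha]; simp only
          generalize (1 + (n : ℝ) / Y₂) = x
          ring
      _ ≤ ∑' n : ℕ, ((1 + (n : ℝ) / Y₂) ^ 8)⁻¹ * (n.divisors.card : ℝ) ^ 2 :=
          hsd.sum_le_tsum s fun n _ => by positivity
      _ ≤ Cd * Y₂ * (1 + Real.log Y₂) ^ 4 := hbd
  have hB2 : ∀ s : Finset ℕ, ∑ n ∈ s, b n ^ 2 ≤ 3 + Real.log Y₂ := by
    intro s
    calc ∑ n ∈ s, b n ^ 2 = ∑ n ∈ s, ((n : ℝ)⁻¹ * ((1 + (n : ℝ) / Y₂) ^ 2)⁻¹) := by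
          refine Finset.sum_congr rfl fun n _ => ?_
          rw [hb]; simp only
          have h1 : ((n : ℝ) ^ (-(1 / 2 : ℝ))) ^ 2 = (n : ℝ)⁻¹ := by
            rw [← Real.rpow_natCast, ← Real.rpow_mul (Nat.cast_nonneg n), ← Real.rpow_neg_one]
            norm_num
          have h2 : (((1 + (n : ℝ) / Y₂) ^ 1)⁻¹) ^ 2 = ((1 + (n : ℝ) / Y₂) ^ 2)⁻¹ := by
            generalize (1 + (n : ℝ) / Y₂) = x
            ring
          rw [mul_pow, h1, h2]
      _ ≤ 3 + Real.log Y₂ := sum_inv_mul_weight_two_le s hY₂2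
  -- the bound for every finite partial sum, hence for the `tsum`
  have hB : ‖(afeA K ψ q w - afeA K ψ q w') / ((t : ℂ) * I - t' * I)‖ ≤
      CΩ * (1 + Real.log Y₂) * (Real.sqrt (Cd * Y₂ * (1 + Real.log Y₂) ^ 4) *
        Real.sqrt (3 + Real.log Y₂)) := by
    rw [hw, hw', hBeq]
    have hsumN : Summable fun n => ‖f n‖ := hsumB.norm
    have h1 : ‖∑' n : ℕ, f n‖ ≤ ∑' n : ℕ, ‖f n‖ := norm_tsum_le_tsum_norm hsumN
    refine h1.trans (hsumN.tsum_le_of_sum_le fun s => ?_)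
    calc ∑ n ∈ s, ‖f n‖ ≤ ∑ n ∈ s, CΩ * (1 + Real.log Y₂) * (a n * b n) :=
          Finset.sum_le_sum fun n _ => hterm n
      _ = CΩ * (1 + Real.log Y₂) * ∑ n ∈ s, a n * b n := by rw [Finset.mul_sum]
      _ ≤ CΩ * (1 + Real.log Y₂) * (Real.sqrt (∑ n ∈ s, a n ^ 2) * Real.sqrt (∑ n ∈ s, b n ^ 2)) := by
          gcongr
          rw [← Real.sqrt_mul (Finset.sum_nonneg fun i _ => sq_nonneg (a i))]
          exact (le_abs_self _).trans (Real.abs_le_sqrt (Finset.sum_mul_sq_le_sq_mul_sq s a b))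
      _ ≤ CΩ * (1 + Real.log Y₂) * (Real.sqrt (Cd * Y₂ * (1 + Real.log Y₂) ^ 4) *
          Real.sqrt (3 + Real.log Y₂)) := by
          gcongr
          · exact hA2 s
          · exact hB2 s
  have h0 : 0 ≤ ‖(afeA K ψ q w - afeA K ψ q w') / ((t : ℂ) * I - t' * I)‖ := norm_nonneg _
  calc ‖(afeA K ψ q w - afeA K ψ q w') / ((t : ℂ) * I - t' * I)‖ ^ 2
      ≤ (CΩ * (1 + Real.log Y₂) * (Real.sqrt (Cd * Y₂ * (1 + Real.log Y₂) ^ 4) *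
          Real.sqrt (3 + Real.log Y₂))) ^ 2 := pow_le_pow_left₀ h0 hB 2
    _ = CΩ ^ 2 * Cd * Y₂ * (1 + Real.log Y₂) ^ 6 * (3 + Real.log Y₂) := by
        rw [mul_pow, mul_pow, mul_pow, Real.sq_sqrt (by positivity), Real.sq_sqrt (by positivity)]
        ring
    _ = CΩ ^ 2 * Cd * (condQ q * (‖(1 / 2 : ℂ) + t * I‖ + 1) + 2) *
          (1 + Real.log (condQ q * (‖(1 / 2 : ℂ) + t * I‖ + 1) + 2)) ^ 6 *
          (3 + Real.log (condQ q * (‖(1 / 2 : ℂ) + t * I‖ + 1) + 2)) := by rw [hY₂, hw]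

/-! ### §3. The height form of the pointwise bounds -/

/-- **`|A(½+iu)|² ≤ C·qT(log T)^5`** for `1 ≤ |u| ≤ 2T + 1`, `3 ≤ T`, `q ≤ T`, `Q(2T+2) ≤ qT`
(`Y₂ = Q|½+iu| + 2 ≤ 2qT`, `log Y₂ ≤ 3 log T`). [cite: ConreyIwaniec2002, Lemma 7.2 (7.16)] -/
theorem norm_afeA_sq_le_height :
    ∃ C : ℝ, 0 < C ∧
    ∀ (q : ℕ) [NeZero q], 4 < q → ∀ χ : DirichletCharacter ℂ q,
      χ.IsPrimitive → χ.IsQuadratic → χ.Odd →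
        ∀ (K : Type) [Field K] [NumberField K],
          Module.finrank ℚ K = 2 → NumberField.discr K = -(q : ℤ) →
            ∀ (ψ : ClassGroup (𝓞 K) →* ℂˣ) (T u : ℝ),
              3 ≤ T → (q : ℝ) ≤ T → condQ q * (2 * T + 2) ≤ q * T → 1 ≤ |u| → |u| ≤ 2 * T + 1 →
                ‖afeA K ψ q (1 / 2 + u * I)‖ ^ 2 ≤ C * ((q : ℝ) * T * Real.log T ^ 5) := by
  obtain ⟨CA, hCA, hA⟩ := norm_afeA_sq_le_conv
  refine ⟨(2 * 4 ^ 4 * 6) * CA, by positivity,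
    fun q _ hq χ hprim hquad hoddχ K _ _ h2 hdisc ψ T u hT3 hqT hQT hu1 hu2T => ?_⟩
  have hq0 : 0 < q := by omega
  have hq5 : (5 : ℝ) ≤ q := by exact_mod_cast hq
  have hqpos : (0 : ℝ) < q := by linarith
  have hT0 : 0 < T := by linarith
  have hlogT : 1 ≤ Real.log T := by
    rw [Real.le_log_iff_exp_le hT0]; exact Real.exp_one_lt_d9.le.trans (by linarith)
  have hlogq : Real.log q ≤ Real.log T := Real.log_le_log hqpos hqT
  have hAu := hA q hq χ hprim hquad hoddχ K h2 hdisc ψ u hu1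
  set Y₂ : ℝ := condQ q * ‖(1 / 2 : ℂ) + u * I‖ + 2 with hY₂
  have hQ0 : 0 < condQ q := condQ_pos hq0
  have hnorm : ‖(1 / 2 : ℂ) + u * I‖ ≤ 2 * T + 2 := by
    calc ‖(1 / 2 : ℂ) + u * I‖ ≤ ‖(1 / 2 : ℂ)‖ + ‖(u : ℂ) * I‖ := norm_add_le _ _
      _ = 1 / 2 + |u| := by
          rw [norm_mul, Complex.norm_I, mul_one, Complex.norm_real, Real.norm_eq_abs]
          norm_num
      _ ≤ 2 * T + 2 := by linarith
  have hY2T : Y₂ ≤ 2 * (q * T) := by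
    have h1 : condQ q * ‖(1 / 2 : ℂ) + u * I‖ ≤ condQ q * (2 * T + 2) :=
      mul_le_mul_of_nonneg_left hnorm hQ0.le
    have : (2 : ℝ) ≤ q * T := by nlinarith
    rw [hY₂]; linarith
  have hY0 : 1 ≤ Y₂ := by
    have : 0 ≤ condQ q * ‖(1 / 2 : ℂ) + u * I‖ := by positivity
    rw [hY₂]; linarith
  have hY0' : 0 < Y₂ := by linarith
  have hlogY : Real.log Y₂ ≤ 3 * Real.log T := by
    have h1 : Real.log Y₂ ≤ Real.log (2 * (q * T)) := Real.log_le_log hY0' hY2T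
    have h2 : Real.log (2 * (q * T)) = Real.log 2 + Real.log q + Real.log T := by
      rw [Real.log_mul (by norm_num) (by positivity), Real.log_mul hqpos.ne' hT0.ne']; ring
    have h3 : Real.log 2 ≤ Real.log T := Real.log_le_log (by norm_num) (by linarith)
    linarith
  have hlogY0 : 0 ≤ Real.log Y₂ := Real.log_nonneg hY0
  have hf1 : (1 + Real.log Y₂) ^ 4 ≤ (4 * Real.log T) ^ 4 :=
    pow_le_pow_left₀ (by positivity) (by linarith) 4
  have hf2 : 3 + Real.log Y₂ ≤ 6 * Real.log T := by linarith
  refine hAu.trans ?_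
  calc CA * Y₂ * (1 + Real.log Y₂) ^ 4 * (3 + Real.log Y₂)
      ≤ CA * (2 * (q * T)) * (4 * Real.log T) ^ 4 * (6 * Real.log T) := by gcongr
    _ = (2 * 4 ^ 4 * 6) * CA * ((q : ℝ) * T * Real.log T ^ 5) := by ring

/-- **`|B(s)|² ≤ C·qT(log T)^7`** for `s = ½+it`, `2 ≤ |t| ≤ 2T`, `0 < |t − t′| ≤ 1`, `3 ≤ T`,
`q ≤ T`, `Q(2T+2) ≤ qT` (`Y₂ = Q(|s|+1) + 2 ≤ 2qT`). [cite: ConreyIwaniec2002, §7 (7.21)–(7.23)] -/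
theorem norm_afeB_sq_le_height :
    ∃ C : ℝ, 0 < C ∧
    ∀ (q : ℕ) [NeZero q], 4 < q → ∀ χ : DirichletCharacter ℂ q,
      χ.IsPrimitive → χ.IsQuadratic → χ.Odd →
        ∀ (K : Type) [Field K] [NumberField K],
          Module.finrank ℚ K = 2 → NumberField.discr K = -(q : ℤ) →
            ∀ (ψ : ClassGroup (𝓞 K) →* ℂˣ) (T t t' : ℝ),
              3 ≤ T → (q : ℝ) ≤ T → condQ q * (2 * T + 2) ≤ q * T → 2 ≤ |t| → |t| ≤ 2 * T →
                t' ≠ t → |t' - t| ≤ 1 →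
                ‖(afeA K ψ q (1 / 2 + t * I) - afeA K ψ q (1 / 2 + t' * I)) / ((t : ℂ) * I - t' * I)‖ ^ 2 ≤
                  C * ((q : ℝ) * T * Real.log T ^ 7) := by
  obtain ⟨CB, hCB, hB⟩ := norm_afeB_sq_le_conv
  refine ⟨(2 * 4 ^ 6 * 6) * CB, by positivity,
    fun q _ hq χ hprim hquad hoddχ K _ _ h2 hdisc ψ T t t' hT3 hqT hQT ht2 ht2T htt' hdist => ?_⟩
  have hq0 : 0 < q := by omega
  have hq5 : (5 : ℝ) ≤ q := by exact_mod_cast hq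
  have hqpos : (0 : ℝ) < q := by linarith
  have hT0 : 0 < T := by linarith
  have hlogT : 1 ≤ Real.log T := by
    rw [Real.le_log_iff_exp_le hT0]; exact Real.exp_one_lt_d9.le.trans (by linarith)
  have hlogq : Real.log q ≤ Real.log T := Real.log_le_log hqpos hqT
  have hBt := hB q hq χ hprim hquad hoddχ K h2 hdisc ψ t t' ht2 htt' hdist
  set Y₂ : ℝ := condQ q * (‖(1 / 2 : ℂ) + t * I‖ + 1) + 2 with hY₂
  have hQ0 : 0 < condQ q := condQ_pos hq0
  have hnorm : ‖(1 / 2 : ℂ) + t * I‖ + 1 ≤ 2 * T + 2 := by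
    have : ‖(1 / 2 : ℂ) + t * I‖ ≤ 1 / 2 + |t| := by
      calc ‖(1 / 2 : ℂ) + t * I‖ ≤ ‖(1 / 2 : ℂ)‖ + ‖(t : ℂ) * I‖ := norm_add_le _ _
        _ = 1 / 2 + |t| := by
            rw [norm_mul, Complex.norm_I, mul_one, Complex.norm_real, Real.norm_eq_abs]
            norm_num
    linarith
  have hY2T : Y₂ ≤ 2 * (q * T) := by
    have h1 : condQ q * (‖(1 / 2 : ℂ) + t * I‖ + 1) ≤ condQ q * (2 * T + 2) :=
      mul_le_mul_of_nonneg_left hnorm hQ0.le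
    have : (2 : ℝ) ≤ q * T := by nlinarith
    rw [hY₂]; linarith
  have hY0 : 1 ≤ Y₂ := by
    have : 0 ≤ condQ q * (‖(1 / 2 : ℂ) + t * I‖ + 1) := by positivity
    rw [hY₂]; linarith
  have hY0' : 0 < Y₂ := by linarith
  have hlogY : Real.log Y₂ ≤ 3 * Real.log T := by
    have h1 : Real.log Y₂ ≤ Real.log (2 * (q * T)) := Real.log_le_log hY0' hY2T
    have h2 : Real.log (2 * (q * T)) = Real.log 2 + Real.log q + Real.log T := by
      rw [Real.log_mul (by norm_num) (by positivity), Real.log_mul hqpos.ne' hT0.ne']; ring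
    have h3 : Real.log 2 ≤ Real.log T := Real.log_le_log (by norm_num) (by linarith)
    linarith
  have hlogY0 : 0 ≤ Real.log Y₂ := Real.log_nonneg hY0
  have hf1 : (1 + Real.log Y₂) ^ 6 ≤ (4 * Real.log T) ^ 6 :=
    pow_le_pow_left₀ (by positivity) (by linarith) 6
  have hf2 : 3 + Real.log Y₂ ≤ 6 * Real.log T := by linarith
  refine hBt.trans ?_
  calc CB * Y₂ * (1 + Real.log Y₂) ^ 6 * (3 + Real.log Y₂)
      ≤ CB * (2 * (q * T)) * (4 * Real.log T) ^ 6 * (6 * Real.log T) := by gcongr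
    _ = (2 * 4 ^ 6 * 6) * CB * ((q : ℝ) * T * Real.log T ^ 7) := by ring

/-! ### §4. The mollifier `M(s)` pointwise -/

variable (K : Type) [Field K] [NumberField K] in
/-- **`|M(½+it)| ≤ q²(1 + log q⁴)²`**: `|λ*(m)| ≤ d(m)` (9.4), Cauchy on `Σ_{m≤q⁴} d(m)m^{−1/2}` and
`Σ_{m≤N} d(m)²/m ≤ (1 + log N)⁴`. [cite: ConreyIwaniec2002, §9 (9.4)–(9.5)] -/
theorem norm_shortInvSum_half_le {q : ℕ} [NeZero q] (hq : 4 < q) {χ : DirichletCharacter ℂ q}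
    (hprim : χ.IsPrimitive) (hquad : χ.IsQuadratic) (hodd : χ.Odd)
    (h2 : Module.finrank ℚ K = 2) (hdisc : NumberField.discr K = -(q : ℤ))
    (ψ : ClassGroup (𝓞 K) →* ℂˣ) (t : ℝ) :
    ‖shortInvSum K ψ q (1 / 2 + t * I)‖ ≤
      (q : ℝ) ^ 2 * (1 + Real.log ((q ^ 4 : ℕ) : ℝ)) ^ 2 := by
  classical
  have hq0 : 0 < q := by omega
  set N : ℕ := q ^ 4 with hN
  set ν := classGroupCharIdealHom ψ with hνdef
  -- termwise `‖λ*(m) m^{-(1/2+it)}‖ ≤ d(m) m^{-1/2}`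
  set f : ℕ → ℝ := fun m => (m.divisors.card : ℝ) * (m : ℝ) ^ (-(1 / 2 : ℝ)) with hf
  have hterm : ∀ m ∈ Finset.Icc 1 N,
      ‖twistMoebius K ν m * (m : ℂ) ^ (-(1 / 2 + (t : ℂ) * I))‖ ≤ f m := by
    intro m hm
    rw [Finset.mem_Icc] at hm
    have hm0 : m ≠ 0 := by omega
    have hmpos : 0 < m := by omega
    rw [norm_mul, Complex.norm_natCast_cpow_of_pos hmpos]
    have hre : (-(1 / 2 + (t : ℂ) * I)).re = -(1 / 2 : ℝ) := by simp
    rw [hre, hf]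
    have hlam : ‖twistMoebius K ν m‖ ≤ (m.divisors.card : ℝ) :=
      (norm_twistMoebius_le (norm_classGroupCharIdealHom_le ψ) m).trans
        (idealNormCount_le_card_divisors_of_quadratic hprim hquad hodd K h2 hdisc hm0)
    exact mul_le_mul_of_nonneg_right hlam (Real.rpow_nonneg (Nat.cast_nonneg m) _)
  -- Cauchy: `Σ f ≤ √(Σ d²/m) √N`
  have hsum : ∑ m ∈ Finset.Icc 1 N, f m ≤
      Real.sqrt (∑ m ∈ Finset.Icc 1 N, (m.divisors.card : ℝ) ^ 2 / m) * Real.sqrt N := by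
    have h := Real.abs_le_sqrt (Finset.sum_mul_sq_le_sq_mul_sq (Finset.Icc 1 N) f (fun _ => (1 : ℝ)))
    have e1 : ∑ m ∈ Finset.Icc 1 N, f m * 1 = ∑ m ∈ Finset.Icc 1 N, f m := by simp
    have e2 : ∑ m ∈ Finset.Icc 1 N, f m ^ 2 = ∑ m ∈ Finset.Icc 1 N, (m.divisors.card : ℝ) ^ 2 / m := by
      refine Finset.sum_congr rfl fun m hm => ?_
      rw [Finset.mem_Icc] at hm
      have hmpos : (0 : ℝ) < m := by exact_mod_cast (by omega : 0 < m)
      rw [hf]; simp only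
      rw [mul_pow, ← Real.rpow_natCast ((m : ℝ) ^ (-(1 / 2 : ℝ))) 2, ← Real.rpow_mul hmpos.le]
      norm_num
      rw [Real.rpow_neg_one, div_eq_mul_inv]
    have e3 : ∑ m ∈ Finset.Icc 1 N, (fun _ => (1 : ℝ)) m ^ 2 = N := by simp
    rw [e1, e2, e3, Real.sqrt_mul (Finset.sum_nonneg fun m _ => by positivity)] at h
    exact (le_abs_self _).trans h
  have hds := ZetaM4D.sum_card_divisors_sq_div_le N
  have hsqN : Real.sqrt N = (q : ℝ) ^ 2 := by
    rw [hN]; push_cast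
    rw [show ((q : ℝ)) ^ 4 = ((q : ℝ) ^ 2) ^ 2 by ring, Real.sqrt_sq (by positivity)]
  have hlog0 : 0 ≤ 1 + Real.log (N : ℝ) := by
    have : (1 : ℝ) ≤ N := by rw [hN]; exact_mod_cast Nat.one_le_pow _ _ hq0
    have := Real.log_nonneg this
    linarith
  calc ‖shortInvSum K ψ q (1 / 2 + t * I)‖
      ≤ ∑ m ∈ Finset.Icc 1 N, ‖twistMoebius K ν m * (m : ℂ) ^ (-(1 / 2 + (t : ℂ) * I))‖ := by
        unfold shortInvSum; exact norm_sum_le _ _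
    _ ≤ ∑ m ∈ Finset.Icc 1 N, f m := Finset.sum_le_sum hterm
    _ ≤ Real.sqrt (∑ m ∈ Finset.Icc 1 N, (m.divisors.card : ℝ) ^ 2 / m) * Real.sqrt N := hsum
    _ ≤ Real.sqrt ((1 + Real.log (N : ℝ)) ^ 4) * Real.sqrt N := by gcongr
    _ = (q : ℝ) ^ 2 * (1 + Real.log ((q ^ 4 : ℕ) : ℝ)) ^ 2 := by
        rw [hsqN, show (1 + Real.log (N : ℝ)) ^ 4 = ((1 + Real.log (N : ℝ)) ^ 2) ^ 2 by ring,
          Real.sqrt_sq (by positivity), hN, mul_comm]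

/-! ### §5. The divided difference `ℓ(s)` for a close companion, pointwise -/

/-- **`|ℓ(s)| ≤ |x(s)||A(s)| + 2|B(s)| + |r(s)|`** for `s = ½+it`, `s′ = ½+it′`, `t′ ≠ t` (both
`≠ 0`): Proposition 7.1 at `s` and `s′` with `W(ψ) = 1` (the tree's `pointwise_identity` with
`N = 0`, `|X(s′)| = 1`). [cite: ConreyIwaniec2002, §7 (7.23)] -/
theorem norm_dividedDifference_le_close {q : ℕ} [NeZero q] (hq : 4 < q) (hodd : Odd q)
    (K : Type) [Field K] [NumberField K] (h2 : Module.finrank ℚ K = 2)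
    (hdisc : NumberField.discr K = -(q : ℤ)) (ψ : ClassGroup (𝓞 K) →* ℂˣ) {t t' : ℝ}
    (ht : t ≠ 0) (ht' : t' ≠ 0) (htt' : t' ≠ t) :
    ‖dividedDifference (classGroupLFunction K ψ) (1 / 2 + t * I) (1 / 2 + t' * I)‖ ≤
      ‖xQuot q (1 / 2 + t * I) (1 / 2 + t' * I)‖ * ‖afeA K ψ q (1 / 2 + t * I)‖ +
        2 * ‖(afeA K ψ q (1 / 2 + t * I) - afeA K ψ q (1 / 2 + t' * I)) / ((t : ℂ) * I - t' * I)‖ +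
        ‖(afeR K ψ q (1 / 2 + t * I) - afeR K ψ q (1 / 2 + t' * I)) / ((t : ℂ) * I - t' * I)‖ := by
  have hq0 : 0 < q := by omega
  have hW : (ψ (differentClass K) : ℂ) = 1 := by
    rw [Literature.NumberTheory.QuadraticFields.Quadratic.differentClass_eq_one_of_finrank_eq_two K h2,
      map_one, Units.val_one]
  have hid := pointwise_identity (L := classGroupLFunction K ψ) (A := afeA K ψ q)
    (X := afeX q) (R := afeR K ψ q) htt' (0 : ℂ)
    (by have := classGroupLFunction_eq_afe_all q hq hodd K h2 hdisc ψ t ht; rwa [hW, one_mul] at this)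
    (by have := classGroupLFunction_eq_afe_all q hq hodd K h2 hdisc ψ t' ht'; rwa [hW, one_mul] at this)
  rw [map_zero, mul_zero, sub_zero, sub_zero] at hid
  have hX1 : ‖afeX q (1 / 2 + t' * I)‖ = 1 := norm_afeX_half q hq0 t'
  set ℓv := dividedDifference (classGroupLFunction K ψ) (1 / 2 + t * I) (1 / 2 + t' * I)
  set B := (afeA K ψ q (1 / 2 + t * I) - afeA K ψ q (1 / 2 + t' * I)) / ((t : ℂ) * I - t' * I)
  set xq := dividedDifference (afeX q) (1 / 2 + t * I) (1 / 2 + t' * I)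
  set A := afeA K ψ q (1 / 2 + t * I)
  set r := (afeR K ψ q (1 / 2 + t * I) - afeR K ψ q (1 / 2 + t' * I)) / ((t : ℂ) * I - t' * I)
  have hxq : xQuot q (1 / 2 + t * I) (1 / 2 + t' * I) = xq := rfl
  rw [hxq, hid]
  calc ‖B - afeX q (1 / 2 + t' * I) * starRingEnd ℂ B + xq * starRingEnd ℂ A + r‖
      ≤ ‖B - afeX q (1 / 2 + t' * I) * starRingEnd ℂ B + xq * starRingEnd ℂ A‖ + ‖r‖ := norm_add_le _ _
    _ ≤ ‖B - afeX q (1 / 2 + t' * I) * starRingEnd ℂ B‖ + ‖xq * starRingEnd ℂ A‖ + ‖r‖ := by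
        gcongr; exact norm_add_le _ _
    _ ≤ (‖B‖ + ‖afeX q (1 / 2 + t' * I) * starRingEnd ℂ B‖) + ‖xq‖ * ‖A‖ + ‖r‖ := by
        gcongr
        · exact norm_sub_le _ _
        · rw [norm_mul, RCLike.norm_conj]
    _ = ‖xq‖ * ‖A‖ + 2 * ‖B‖ + ‖r‖ := by rw [norm_mul, hX1, RCLike.norm_conj]; ring

/-! ### §6. Coincident companions in `E(T)` by a limit -/

/-- **Coincident companions by a limit, for `E`.** Each summand of `E` is continuous in the companion
at the diagonal (`(L(s) − L(s′))/(s − s′) → L′(s)`, `(X(s) − X(s′))/(s − s′) → X′(s)`), so a bound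
for all companion maps with perturbed coincident companions `t′ = t + ε`, `0 < ε ≤ 1`, gives the same
bound for the given map (the `E`-analogue of the tree's `defectD_limit`).
[cite: ConreyIwaniec2002, §8 (8.4), §9 (9.6)] -/
theorem defectE_limit {K : Type} [Field K] [NumberField K] (ψ : ClassGroup (𝓞 K) →* ℂˣ)
    {q : ℕ} (hq : 0 < q) (S : Finset ℝ) (hS : ∀ t ∈ S, 0 < t) (t' : ℝ → ℝ) {B : ℝ}
    (h : ∀ ε : ℝ, 0 < ε → ε ≤ 1 →
      defectE K ψ q S (fun t => if t' t = t then t + ε else t' t) ≤ B) :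
    defectE K ψ q S t' ≤ B := by
  classical
  set L := classGroupLFunction K ψ with hL
  set F : ℝ → ℝ → ℝ := fun t ε =>
    ‖dividedDifference L (1 / 2 + t * I) (1 / 2 + ↑(if t' t = t then t + ε else t' t) * I) *
        starRingEnd ℂ (shortInvSum K ψ q (1 / 2 + t * I)) -
      xQuot q (1 / 2 + t * I) (1 / 2 + ↑(if t' t = t then t + ε else t' t) * I)‖ with hF
  have hDε : ∀ ε, defectE K ψ q S (fun t => if t' t = t then t + ε else t' t) = ∑ t ∈ S, F t ε := by
    intro ε; rfl
  have hD0 : defectE K ψ q S t' = ∑ t ∈ S, F t 0 := by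
    unfold defectE; refine Finset.sum_congr rfl fun t _ => ?_
    simp only [hF, add_zero]
    split_ifs with h0
    · rw [h0]
    · rfl
  have hcont : ∀ t ∈ S, Tendsto (F t) (𝓝[>] 0) (𝓝 (F t 0)) := by
    intro t ht
    by_cases h0 : t' t = t
    · have hs1 : (1 / 2 + t * I : ℂ) ≠ 1 := by
        intro h; have := congrArg Complex.im h; simp at this; linarith [hS t ht]
      have hLd : HasDerivAt L (deriv L (1 / 2 + t * I)) (1 / 2 + t * I) :=
        ((analyticAt_classGroupLFunction ψ hs1).differentiableAt).hasDerivAt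
      have hXd : HasDerivAt (afeX q) (deriv (afeX q) (1 / 2 + t * I)) (1 / 2 + t * I) :=
        (hasDerivAt_afeX hq (by simp) (by simp; norm_num)).differentiableAt.hasDerivAt
      have hpath : Tendsto (fun ε : ℝ => (1 / 2 + ↑(t + ε) * I : ℂ)) (𝓝[>] 0)
          (𝓝[≠] (1 / 2 + t * I)) := by
        refine tendsto_nhdsWithin_of_tendsto_nhds_of_eventually_within _ ?_ ?_
        · have hc : Continuous (fun ε : ℝ => (1 / 2 + ↑(t + ε) * I : ℂ)) := by fun_prop
          have h : Tendsto (fun ε : ℝ => (1 / 2 + ↑(t + ε) * I : ℂ)) (𝓝[>] 0)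
              (𝓝 (1 / 2 + ↑(t + 0) * I)) :=
            (hc.tendsto 0).mono_left nhdsWithin_le_nhds
          simpa using h
        · filter_upwards [self_mem_nhdsWithin] with ε (hε : 0 < ε)
          intro h
          have := congrArg Complex.im h
          simp at this
          linarith
      have hslopeL := (hLd.tendsto_slope).comp hpath
      have hslopeX := (hXd.tendsto_slope).comp hpath
      have hdd : ∀ (f : ℂ → ℂ) (ε : ℝ), 0 < ε →
          dividedDifference f (1 / 2 + t * I) (1 / 2 + ↑(t + ε) * I) =
            slope f (1 / 2 + t * I) (1 / 2 + ↑(t + ε) * I) := by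
        intro f ε hε
        have hne : (1 / 2 + ↑(t + ε) * I : ℂ) ≠ 1 / 2 + t * I := by
          intro h; have := congrArg Complex.im h; simp at this; linarith
        rw [dividedDifference_of_ne f hne, slope_def_field,
          ← neg_sub (f (1 / 2 + ↑(t + ε) * I)) (f (1 / 2 + t * I)),
          ← neg_sub (1 / 2 + ↑(t + ε) * I : ℂ) (1 / 2 + t * I), neg_div_neg_eq]
      have hFε : ∀ ε : ℝ, 0 < ε → F t ε =
          ‖slope L (1 / 2 + t * I) (1 / 2 + ↑(t + ε) * I) *
              starRingEnd ℂ (shortInvSum K ψ q (1 / 2 + t * I)) -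
            slope (afeX q) (1 / 2 + t * I) (1 / 2 + ↑(t + ε) * I)‖ := by
        intro ε hε
        simp only [hF, h0, if_true, xQuot]
        rw [hdd L ε hε, hdd (afeX q) ε hε]
      have hF0 : F t 0 = ‖deriv L (1 / 2 + t * I) * starRingEnd ℂ (shortInvSum K ψ q (1 / 2 + t * I)) -
          deriv (afeX q) (1 / 2 + t * I)‖ := by
        simp only [hF, h0, if_true, add_zero, dividedDifference_self, xQuot_self]
      rw [hF0]
      have hlim : Tendsto (fun ε : ℝ => ‖slope L (1 / 2 + t * I) (1 / 2 + ↑(t + ε) * I) *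
              starRingEnd ℂ (shortInvSum K ψ q (1 / 2 + t * I)) -
            slope (afeX q) (1 / 2 + t * I) (1 / 2 + ↑(t + ε) * I)‖) (𝓝[>] 0)
          (𝓝 (‖deriv L (1 / 2 + t * I) * starRingEnd ℂ (shortInvSum K ψ q (1 / 2 + t * I)) -
            deriv (afeX q) (1 / 2 + t * I)‖)) :=
        ((hslopeL.mul_const _).sub hslopeX).norm
      refine hlim.congr' ?_
      filter_upwards [self_mem_nhdsWithin] with ε (hε : 0 < ε)
      exact (hFε ε hε).symm
    · have : F t = fun _ => F t 0 := by
        funext ε; simp only [hF, h0, if_false]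
      rw [this]; exact tendsto_const_nhds
  have hlim : Tendsto (fun ε => ∑ t ∈ S, F t ε) (𝓝[>] 0) (𝓝 (∑ t ∈ S, F t 0)) :=
    tendsto_finsetSum S hcont
  rw [hD0]
  refine le_of_tendsto hlim ?_
  have hmem : Set.Ioc (0 : ℝ) 1 ∈ 𝓝[>] (0 : ℝ) := Ioc_mem_nhdsGT (by norm_num)
  filter_upwards [hmem] with ε hε
  rw [← hDε]
  exact h ε hε.1 hε.2

/-! ### §7. The summand of `E(T)` pointwise -/

set_option maxHeartbeats 400000 in
/-- **THE SUMMAND OF `E(T)` POINTWISE**: for `q` odd `> 4`, `K = ℚ(√−q)`, `ψ ∈ Ĉℓ(K)`, `q^65 ≤ T`,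
`T < t ≤ 2T` and ANY `t′ ≠ t`: `|ℓ(s)M̄(s) − x(s)| ≤ C·q³·√T·(log T)^6` — close companions by
`|ℓ| ≤ |x||A| + 2|B| + |r|` and the height bounds, far ones by `|ℓ| ≤ (|L(s)| + |L(s′)|)/|t − t′|`
with the convexity-strength `|L(½+iu)|² ≪ qT(log T)^5` (`|u − t| ≤ T/4`) or `|L(s′)|²/|t−t′|² ≪ 1`
(`|u − t| > T/4`); `|M(s)| ≤ 25q²(log T)²`. [cite: ConreyIwaniec2002, §9 (9.6); (7.19)–(7.23)] -/
theorem bottom_pointwise :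
    ∃ C : ℝ, 0 < C ∧
    ∀ (q : ℕ) [NeZero q], 4 < q → Odd q → ∀ χ : DirichletCharacter ℂ q,
      χ.IsPrimitive → χ.IsQuadratic → χ.Odd →
        ∀ (K : Type) [Field K] [NumberField K],
          Module.finrank ℚ K = 2 → NumberField.discr K = -(q : ℤ) →
            ∀ (ψ : ClassGroup (𝓞 K) →* ℂˣ) (T t t' : ℝ),
              (q : ℝ) ^ (65 : ℕ) ≤ T → T < t → t ≤ 2 * T → t' ≠ t →
                ‖dividedDifference (classGroupLFunction K ψ) (1 / 2 + t * I) (1 / 2 + t' * I) *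
                      starRingEnd ℂ (shortInvSum K ψ q (1 / 2 + t * I)) -
                    xQuot q (1 / 2 + t * I) (1 / 2 + t' * I)‖ ≤
                  C * ((q : ℝ) ^ 3 * Real.sqrt T * Real.log T ^ 6) := by
  obtain ⟨C₃, hC₃, hx⟩ := norm_xQuot_le
  obtain ⟨KA, hKA, hA⟩ := norm_afeA_sq_le_height
  obtain ⟨KB, hKB, hB⟩ := norm_afeB_sq_le_height
  obtain ⟨MR, hMR, hR⟩ := norm_dividedDiff_afeR_one_le
  obtain ⟨Kv, hKv, hconv⟩ := norm_sq_classGroupLFunction_le_conv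
  obtain ⟨Kc, hKc, hrem⟩ := norm_sq_le_sq_dist_of_remote
  refine ⟨75 * C₃ * Real.sqrt KA + 50 * Real.sqrt KB + 100 * MR + 3 * C₃ + 400 * Real.sqrt Kv +
      25 * Real.sqrt Kc + 4, by positivity,
    fun q _ hq hodd χ hprim hquad hoddχ K _ _ h2 hdisc ψ T t t' hT hTt ht2T htt' => ?_⟩
  -- numerics at the levels `T` and `2T`
  obtain ⟨hℓ1, -, hLT1, hℓle, hq41, -, hT3, hQT, -, -, -, hqT⟩ := prop81_numerics65 hq hT
  have hT0 : 0 < T := by linarith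
  have hT2 : (q : ℝ) ^ (65 : ℕ) ≤ 2 * T := by linarith
  obtain ⟨-, -, -, -, -, -, -, hQT2, -, -, -, hqT2⟩ := prop81_numerics65 hq hT2
  have hq0 : 0 < q := by omega
  have hq5 : (5 : ℝ) ≤ q := by exact_mod_cast hq
  have hq1 : (1 : ℝ) ≤ q := by linarith
  have hqpos : (0 : ℝ) < q := by linarith
  have ht0 : 0 < t := by linarith
  have htabs : |t| = t := abs_of_pos ht0
  have hq4cast : ((q ^ 4 : ℕ) : ℝ) = (q : ℝ) ^ (4 : ℕ) := by push_cast; ring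
  have hq4T : (q : ℝ) ^ (4 : ℕ) ≤ T := by linarith
  have h125 : (q : ℝ) * 125 ≤ (q : ℝ) ^ (4 : ℕ) := by
    have h3 : (125 : ℝ) ≤ (q : ℝ) ^ (3 : ℕ) := by
      have := pow_le_pow_left₀ (by norm_num : (0 : ℝ) ≤ 5) hq5 3
      norm_num at this; exact this
    calc (q : ℝ) * 125 ≤ (q : ℝ) * (q : ℝ) ^ (3 : ℕ) := by gcongr
      _ = (q : ℝ) ^ (4 : ℕ) := by ring
  have hqT4 : (q : ℝ) + 1 ≤ 3 * T / 4 := by linarith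
  set ℓ : ℝ := Real.log q with hℓ
  set LT : ℝ := Real.log T with hLT
  have hLT0 : 0 ≤ LT := by linarith
  have hlog2T : Real.log (2 * T) ≤ 2 * LT := by
    rw [Real.log_mul (by norm_num) hT0.ne']
    have : Real.log 2 ≤ LT := le_trans (le_of_lt Real.log_two_lt_d9) (by linarith)
    linarith
  -- the unit `Z = q³ √T (log T)^6` and the monomials
  set rT : ℝ := Real.sqrt T with hrT
  have hrT1 : 1 ≤ rT := by rw [hrT, ← Real.sqrt_one]; exact Real.sqrt_le_sqrt (by linarith)
  have hrT0 : 0 ≤ rT := by linarith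
  have hrTsq : rT * rT = T := Real.mul_self_sqrt hT0.le
  set G : ℝ := (q : ℝ) * rT with hG
  have hG1 : 1 ≤ G := by rw [hG]; exact one_le_mul_of_one_le_of_one_le hq1 hrT1
  set Z : ℝ := (q : ℝ) ^ 3 * rT * LT ^ 6 with hZ
  have hZ0 : 0 ≤ Z := by positivity
  have hLTpow : ∀ {j k : ℕ}, j ≤ k → LT ^ j ≤ LT ^ k := fun h => pow_le_pow_right₀ hLT1 h
  have hq3 : (1 : ℝ) ≤ (q : ℝ) ^ 3 := one_le_pow₀ hq1
  have hm1 : LT ≤ Z := by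
    have h1 : LT = 1 * 1 * LT ^ 1 := by ring
    rw [h1, hZ]
    exact mul_le_mul (mul_le_mul hq3 hrT1 zero_le_one (by positivity)) (hLTpow (by norm_num))
      (by positivity) (by positivity)
  have hm2 : (q : ℝ) ^ 2 * LT ^ 2 ≤ Z := by
    have hq23 : (q : ℝ) ^ 2 ≤ (q : ℝ) ^ 3 := pow_le_pow_right₀ hq1 (by norm_num)
    have h1 : (q : ℝ) ^ 2 * LT ^ 2 = (q : ℝ) ^ 2 * 1 * LT ^ 2 := by ring
    rw [h1, hZ]
    exact mul_le_mul (mul_le_mul hq23 hrT1 zero_le_one (by positivity)) (hLTpow (by norm_num))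
      (by positivity) (by positivity)
  have hm3 : G * LT ^ 4 * ((q : ℝ) ^ 2 * LT ^ 2) = Z := by rw [hG, hZ]; ring
  have hm4 : G * LT ^ 3 * ((q : ℝ) ^ 2 * LT ^ 2) ≤ Z := by
    have : G * LT ^ 3 * ((q : ℝ) ^ 2 * LT ^ 2) = (q : ℝ) ^ 3 * rT * LT ^ 5 := by rw [hG]; ring
    rw [this, hZ]
    exact mul_le_mul_of_nonneg_left (hLTpow (by norm_num)) (by positivity)
  have hm5 : (1 : ℝ) ≤ Z := le_trans hLT1 hm1
  -- square roots of the height bounds: `x² ≤ K·q·T'·LT'^k ≤ (√K·G·LT^m)²`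
  have hsq : ∀ {x y : ℝ}, 0 ≤ x → 0 ≤ y → x ^ 2 ≤ y ^ 2 → x ≤ y := fun hx hy h =>
    (pow_le_pow_iff_left₀ hx hy two_ne_zero).mp h
  -- `|M(s)| ≤ 25 q² LT²`
  have hM : ‖shortInvSum K ψ q (1 / 2 + t * I)‖ ≤ 25 * ((q : ℝ) ^ 2 * LT ^ 2) := by
    have h := norm_shortInvSum_half_le K hq hprim hquad hoddχ h2 hdisc ψ t
    have hlog4 : Real.log ((q ^ 4 : ℕ) : ℝ) = 4 * ℓ := by
      rw [hq4cast, Real.log_pow]; push_cast; ring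
    rw [hlog4] at h
    have h5 : (1 + 4 * ℓ) ^ 2 ≤ (5 * LT) ^ 2 := pow_le_pow_left₀ (by positivity) (by linarith) 2
    calc ‖shortInvSum K ψ q (1 / 2 + t * I)‖ ≤ (q : ℝ) ^ 2 * (1 + 4 * ℓ) ^ 2 := h
      _ ≤ (q : ℝ) ^ 2 * (5 * LT) ^ 2 := by gcongr
      _ = 25 * ((q : ℝ) ^ 2 * LT ^ 2) := by ring
  have hM0 : 0 ≤ ‖shortInvSum K ψ q (1 / 2 + t * I)‖ := norm_nonneg _
  -- `|A(s)| ≤ √KA · G · LT³`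
  have hAt : ‖afeA K ψ q (1 / 2 + t * I)‖ ≤ Real.sqrt KA * G * LT ^ 3 := by
    have h := hA q hq χ hprim hquad hoddχ K h2 hdisc ψ T t hT3 hqT hQT (by rw [htabs]; linarith)
      (by rw [htabs]; linarith)
    have e : (Real.sqrt KA * G * LT ^ 3) ^ 2 = KA * ((q : ℝ) * ((q : ℝ) * T) * LT ^ 6) := by
      rw [mul_pow, mul_pow, Real.sq_sqrt hKA.le, hG, mul_pow, ← hrTsq]; ring
    have h6 : (q : ℝ) * T * LT ^ 5 ≤ (q : ℝ) * ((q : ℝ) * T) * LT ^ 6 := by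
      calc (q : ℝ) * T * LT ^ 5 = 1 * ((q : ℝ) * T) * LT ^ 5 := by ring
        _ ≤ (q : ℝ) * ((q : ℝ) * T) * LT ^ 6 :=
            mul_le_mul (mul_le_mul_of_nonneg_right hq1 (by positivity)) (hLTpow (by norm_num))
              (by positivity) (by positivity)
    have hsq2 : ‖afeA K ψ q (1 / 2 + t * I)‖ ^ 2 ≤ (Real.sqrt KA * G * LT ^ 3) ^ 2 := by
      rw [e]; exact h.trans (mul_le_mul_of_nonneg_left h6 hKA.le)
    exact hsq (norm_nonneg _) (by positivity) hsq2
  -- `|L(½+iu)| ≤ 8√Kv · G · LT³` for `3T/4 ≤ u ≤ 9T/4 + 1`... via the level `2T`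
  have hLu : ∀ u : ℝ, 3 * T / 4 ≤ u → u ≤ 4 * T + 1 →
      ‖classGroupLFunction K ψ (1 / 2 + u * I)‖ ≤ 8 * Real.sqrt Kv * G * LT ^ 3 := by
    intro u hu1 hu2
    have hu0 : 0 < u := by linarith
    have huabs : |u| = u := abs_of_pos hu0
    have h := hconv q hq χ hprim hquad hoddχ K h2 hdisc ψ (2 * T) u (by linarith) hqT2 hQT2
      (by rw [huabs]; linarith) (by rw [huabs]; linarith) (by rw [huabs]; linarith)
    have e : (8 * Real.sqrt Kv * G * LT ^ 3) ^ 2 = Kv * (64 * ((q : ℝ) * ((q : ℝ) * T) * LT ^ 6)) := by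
      rw [mul_pow, mul_pow, mul_pow, Real.sq_sqrt hKv.le, hG, mul_pow, ← hrTsq]; ring
    have hl5 : Real.log (2 * T) ^ 5 ≤ (2 * LT) ^ 5 :=
      pow_le_pow_left₀ (Real.log_nonneg (by linarith)) hlog2T 5
    have h6 : (q : ℝ) * (2 * T) * Real.log (2 * T) ^ 5 ≤ 64 * ((q : ℝ) * ((q : ℝ) * T) * LT ^ 6) := by
      calc (q : ℝ) * (2 * T) * Real.log (2 * T) ^ 5 ≤ (q : ℝ) * (2 * T) * (2 * LT) ^ 5 :=
            mul_le_mul_of_nonneg_left hl5 (by positivity)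
        _ = 64 * (1 * ((q : ℝ) * T) * LT ^ 5) := by ring
        _ ≤ 64 * ((q : ℝ) * ((q : ℝ) * T) * LT ^ 6) :=
            mul_le_mul_of_nonneg_left (mul_le_mul (mul_le_mul_of_nonneg_right hq1 (by positivity))
              (hLTpow (by norm_num)) (by positivity) (by positivity)) (by norm_num)
    have hsq2 : ‖classGroupLFunction K ψ (1 / 2 + u * I)‖ ^ 2 ≤ (8 * Real.sqrt Kv * G * LT ^ 3) ^ 2 := by
      rw [e]; exact h.trans (mul_le_mul_of_nonneg_left h6 hKv.le)
    exact hsq (norm_nonneg _) (by positivity) hsq2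
  set P : ℝ := ‖dividedDifference (classGroupLFunction K ψ) (1 / 2 + t * I) (1 / 2 + t' * I) *
        starRingEnd ℂ (shortInvSum K ψ q (1 / 2 + t * I)) -
      xQuot q (1 / 2 + t * I) (1 / 2 + t' * I)‖ with hP
  -- `P ≤ |ℓ||M| + |x|`
  have hPle : P ≤ ‖dividedDifference (classGroupLFunction K ψ) (1 / 2 + t * I) (1 / 2 + t' * I)‖ *
      ‖shortInvSum K ψ q (1 / 2 + t * I)‖ + ‖xQuot q (1 / 2 + t * I) (1 / 2 + t' * I)‖ := by
    rw [hP]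
    calc ‖dividedDifference (classGroupLFunction K ψ) (1 / 2 + t * I) (1 / 2 + t' * I) *
            starRingEnd ℂ (shortInvSum K ψ q (1 / 2 + t * I)) - xQuot q (1 / 2 + t * I) (1 / 2 + t' * I)‖
        ≤ ‖dividedDifference (classGroupLFunction K ψ) (1 / 2 + t * I) (1 / 2 + t' * I) *
            starRingEnd ℂ (shortInvSum K ψ q (1 / 2 + t * I))‖ + ‖xQuot q (1 / 2 + t * I) (1 / 2 + t' * I)‖ :=
          norm_sub_le _ _
      _ = _ := by rw [norm_mul, RCLike.norm_conj]
  set Cfin : ℝ := 75 * C₃ * Real.sqrt KA + 50 * Real.sqrt KB + 100 * MR + 3 * C₃ + 400 * Real.sqrt Kv +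
      25 * Real.sqrt Kc + 4 with hCfin
  change P ≤ Cfin * ((q : ℝ) ^ 3 * rT * LT ^ 6)
  rw [← hZ]
  by_cases hclose : |t' - t| ≤ 1
  · -- close companion: `|ℓ| ≤ |x||A| + 2|B| + |r|`
    have ht'0 : 0 < t' := by have := (abs_le.mp hclose).1; linarith
    have hxb : ‖xQuot q (1 / 2 + t * I) (1 / 2 + t' * I)‖ ≤ 3 * C₃ * LT := by
      refine (hx q hq t t' (by linarith)).trans ?_
      have hlogt : Real.log t ≤ Real.log (2 * T) := Real.log_le_log ht0 ht2T
      rw [← hℓ]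
      have h3 : ℓ + Real.log t ≤ 3 * LT := by linarith
      calc C₃ * (ℓ + Real.log t) ≤ C₃ * (3 * LT) := mul_le_mul_of_nonneg_left h3 hC₃.le
        _ = 3 * C₃ * LT := by ring
    have hBt : ‖(afeA K ψ q (1 / 2 + t * I) - afeA K ψ q (1 / 2 + t' * I)) / ((t : ℂ) * I - t' * I)‖ ≤
        Real.sqrt KB * G * LT ^ 4 := by
      have h := hB q hq χ hprim hquad hoddχ K h2 hdisc ψ T t t' hT3 hqT hQT (by rw [htabs]; linarith)
        (by rw [htabs]; linarith) htt' hclose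
      have e : (Real.sqrt KB * G * LT ^ 4) ^ 2 = KB * ((q : ℝ) * ((q : ℝ) * T) * LT ^ 8) := by
        rw [mul_pow, mul_pow, Real.sq_sqrt hKB.le, hG, mul_pow, ← hrTsq]; ring
      have h6 : (q : ℝ) * T * LT ^ 7 ≤ (q : ℝ) * ((q : ℝ) * T) * LT ^ 8 := by
        calc (q : ℝ) * T * LT ^ 7 = 1 * ((q : ℝ) * T) * LT ^ 7 := by ring
          _ ≤ (q : ℝ) * ((q : ℝ) * T) * LT ^ 8 :=
              mul_le_mul (mul_le_mul_of_nonneg_right hq1 (by positivity)) (hLTpow (by norm_num))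
                (by positivity) (by positivity)
      have hsq2 : ‖(afeA K ψ q (1 / 2 + t * I) - afeA K ψ q (1 / 2 + t' * I)) / ((t : ℂ) * I - t' * I)‖ ^ 2 ≤
          (Real.sqrt KB * G * LT ^ 4) ^ 2 := by
        rw [e]; exact h.trans (mul_le_mul_of_nonneg_left h6 hKB.le)
      exact hsq (norm_nonneg _) (by positivity) hsq2
    have hrb : ‖(afeR K ψ q (1 / 2 + t * I) - afeR K ψ q (1 / 2 + t' * I)) / ((t : ℂ) * I - t' * I)‖ ≤
        4 * MR := by
      by_cases hψ : ψ = 1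
      · subst hψ
        refine hR q hq0 K h2 hdisc t t' htt' fun u hu => ?_
        have hu1 : t - 1 ≤ u := by
          rcases Set.mem_uIcc.mp hu with ⟨h1, -⟩ | ⟨h1, -⟩
          · have := (abs_le.mp hclose).1; linarith
          · linarith
        have hq2 : (q : ℝ) + 2 ≤ T - 1 := by linarith
        constructor <;> linarith
      · simp [afeR_of_ne_one hψ]; positivity
    have hℓb : ‖dividedDifference (classGroupLFunction K ψ) (1 / 2 + t * I) (1 / 2 + t' * I)‖ ≤
        3 * C₃ * LT * (Real.sqrt KA * G * LT ^ 3) + 2 * (Real.sqrt KB * G * LT ^ 4) + 4 * MR := by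
      refine (norm_dividedDifference_le_close hq hodd K h2 hdisc ψ ht0.ne' ht'0.ne' htt').trans ?_
      have h1 := mul_le_mul hxb hAt (norm_nonneg _) (by positivity : (0 : ℝ) ≤ 3 * C₃ * LT)
      linarith [h1, hBt, hrb]
    have hℓ0 : 0 ≤ ‖dividedDifference (classGroupLFunction K ψ) (1 / 2 + t * I) (1 / 2 + t' * I)‖ :=
      norm_nonneg _
    calc P ≤ (3 * C₃ * LT * (Real.sqrt KA * G * LT ^ 3) + 2 * (Real.sqrt KB * G * LT ^ 4) + 4 * MR) *
          (25 * ((q : ℝ) ^ 2 * LT ^ 2)) + 3 * C₃ * LT :=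
          hPle.trans (add_le_add (mul_le_mul hℓb hM hM0 (hℓ0.trans hℓb)) hxb)
      _ = 75 * C₃ * Real.sqrt KA * (G * LT ^ 4 * ((q : ℝ) ^ 2 * LT ^ 2)) +
          50 * Real.sqrt KB * (G * LT ^ 4 * ((q : ℝ) ^ 2 * LT ^ 2)) +
          100 * MR * ((q : ℝ) ^ 2 * LT ^ 2) + 3 * C₃ * LT := by ring
      _ ≤ 75 * C₃ * Real.sqrt KA * Z + 50 * Real.sqrt KB * Z + 100 * MR * Z + 3 * C₃ * Z := by
          rw [hm3]
          have h1 : 100 * MR * ((q : ℝ) ^ 2 * LT ^ 2) ≤ 100 * MR * Z :=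
            mul_le_mul_of_nonneg_left hm2 (by positivity)
          have h2 : 3 * C₃ * LT ≤ 3 * C₃ * Z := mul_le_mul_of_nonneg_left hm1 (by positivity)
          linarith
      _ ≤ Cfin * Z := by
          rw [hCfin]
          have : 0 ≤ (400 * Real.sqrt Kv + 25 * Real.sqrt Kc + 4) * Z := by positivity
          have e : (75 * C₃ * Real.sqrt KA + 50 * Real.sqrt KB + 100 * MR + 3 * C₃ + 400 * Real.sqrt Kv +
              25 * Real.sqrt Kc + 4) * Z = (75 * C₃ * Real.sqrt KA * Z + 50 * Real.sqrt KB * Z +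
              100 * MR * Z + 3 * C₃ * Z) + (400 * Real.sqrt Kv + 25 * Real.sqrt Kc + 4) * Z := by ring
          linarith
  · -- far companion: `|ℓ| ≤ (|L(s)| + |L(s′)|)/|t − t′|`, `|x| ≤ 2/|t − t′|`
    push Not at hclose
    have hd1 : 1 ≤ |t' - t| := hclose.le
    have hd0 : 0 < |t' - t| := by linarith
    have hxb : ‖xQuot q (1 / 2 + t * I) (1 / 2 + t' * I)‖ ≤ 2 := by
      refine (norm_xQuot_le_two_div hq0 htt').trans ?_
      rw [div_le_iff₀ hd0]; linarith
    have hLt : ‖classGroupLFunction K ψ (1 / 2 + t * I)‖ ≤ 8 * Real.sqrt Kv * G * LT ^ 3 :=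
      hLu t (by linarith) (by linarith)
    -- the companion term `|L(s′)|/|t − t′| ≤ 8√Kv G LT³ + √Kc`
    have hLt' : ‖classGroupLFunction K ψ (1 / 2 + t' * I)‖ / |t' - t| ≤
        8 * Real.sqrt Kv * G * LT ^ 3 + Real.sqrt Kc := by
      by_cases hmid : |t' - t| ≤ T / 4
      · have hc := abs_le.1 hmid
        have h1 := hLu (t') (by linarith) (by linarith)
        have h2 : ‖classGroupLFunction K ψ (1 / 2 + t' * I)‖ / |t' - t| ≤
            ‖classGroupLFunction K ψ (1 / 2 + t' * I)‖ := div_le_self (norm_nonneg _) hd1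
        have h3 : 0 ≤ Real.sqrt Kc := Real.sqrt_nonneg _
        linarith
      · push Not at hmid
        have h := hrem q hq χ hprim hquad hoddχ K h2 hdisc ψ T t t' hq4T hTt ht2T hmid
        have h1 : ‖classGroupLFunction K ψ (1 / 2 + t' * I)‖ / |t' - t| ≤ Real.sqrt Kc := by
          have hd2 : 0 < (t' - t) ^ 2 := by
            have : t' - t ≠ 0 := sub_ne_zero.mpr htt'
            positivity
          have hsq2 : (‖classGroupLFunction K ψ (1 / 2 + t' * I)‖ / |t' - t|) ^ 2 ≤ (Real.sqrt Kc) ^ 2 := by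
            rw [div_pow, sq_abs, Real.sq_sqrt hKc.le, div_le_iff₀ hd2]
            exact h
          exact hsq (by positivity) (Real.sqrt_nonneg _) hsq2
        have h2 : 0 ≤ 8 * Real.sqrt Kv * G * LT ^ 3 := by positivity
        linarith
    have hℓb : ‖dividedDifference (classGroupLFunction K ψ) (1 / 2 + t * I) (1 / 2 + t' * I)‖ ≤
        16 * Real.sqrt Kv * G * LT ^ 3 + Real.sqrt Kc := by
      refine (norm_dividedDifference_half_le (classGroupLFunction K ψ) htt').trans ?_
      rw [add_div]
      have h1 : ‖classGroupLFunction K ψ (1 / 2 + t * I)‖ / |t' - t| ≤ 8 * Real.sqrt Kv * G * LT ^ 3 :=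
        (div_le_self (norm_nonneg _) hd1).trans hLt
      linarith
    have hℓ0 : 0 ≤ ‖dividedDifference (classGroupLFunction K ψ) (1 / 2 + t * I) (1 / 2 + t' * I)‖ :=
      norm_nonneg _
    calc P ≤ (16 * Real.sqrt Kv * G * LT ^ 3 + Real.sqrt Kc) * (25 * ((q : ℝ) ^ 2 * LT ^ 2)) + 2 :=
          hPle.trans (add_le_add (mul_le_mul hℓb hM hM0 (hℓ0.trans hℓb)) hxb)
      _ = 400 * Real.sqrt Kv * (G * LT ^ 3 * ((q : ℝ) ^ 2 * LT ^ 2)) +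
          25 * Real.sqrt Kc * ((q : ℝ) ^ 2 * LT ^ 2) + 2 := by ring
      _ ≤ 400 * Real.sqrt Kv * Z + 25 * Real.sqrt Kc * Z + 2 * Z := by
          have h1 : 400 * Real.sqrt Kv * (G * LT ^ 3 * ((q : ℝ) ^ 2 * LT ^ 2)) ≤ 400 * Real.sqrt Kv * Z :=
            mul_le_mul_of_nonneg_left hm4 (by positivity)
          have h2 : 25 * Real.sqrt Kc * ((q : ℝ) ^ 2 * LT ^ 2) ≤ 25 * Real.sqrt Kc * Z :=
            mul_le_mul_of_nonneg_left hm2 (by positivity)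
          linarith
      _ ≤ Cfin * Z := by
          rw [hCfin]
          have : 0 ≤ (75 * C₃ * Real.sqrt KA + 50 * Real.sqrt KB + 100 * MR + 3 * C₃ + 2) * Z := by
            positivity
          have e : (75 * C₃ * Real.sqrt KA + 50 * Real.sqrt KB + 100 * MR + 3 * C₃ + 400 * Real.sqrt Kv +
              25 * Real.sqrt Kc + 4) * Z = (400 * Real.sqrt Kv * Z + 25 * Real.sqrt Kc * Z + 2 * Z) +
              (75 * C₃ * Real.sqrt KA + 50 * Real.sqrt KB + 100 * MR + 3 * C₃ + 2) * Z := by ring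
          linarith

end ConreyIwaniec2002

end Literature.NumberTheory.LFunctions

end
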